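import Mathlib
import HarnessLib.Audit
import Summits.PneNP.PneNP.Theorems.PstarChordBridgeForest
import Summits.PneNP.PneNP.Theorems.PstarUnionRankSixBridge

/-!
# Single-chord world of Case B: a reader that is released by a path edge is released by the chord (ROUND-24, memo §14.21–§14.22)

FRONTIER range-avoidance ladder, rung F-N3, ROUND 24 (cell `pnp-ideate`, planner memo `r24/CORE-BOUND-NOTES.md` §14.21–§14.22 (Case B of the union lemma, single-chord
world); restricted-model proof complexity — nothing here bears on `P` versus `NP`).

Bridge data `B` for a pair `(R, w₂)` with ONE chord `c₀` (`N = {c₀}`), both constraints gate-free on its privates, `w₂` READING a private of `c₀`, (T3), lift.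
**`false_of_path_release`**: if `(R, w₂)` is NOT released by the chord (`(J₀ − c₀) ∧ R ∧ w₂` unsolvable) then it is released by no path edge `f ∈ D c₀` either.

Proof.  Over the forest `J₀ − c₀` the two privates of `c₀` are free coordinates, so non-release by `c₀` makes the private-read matrix of `(R, w₂)` singular
(`reads_cases`, a finite check): `R`'s private reads are `λ ·` those of `w₂`, and the blind combination `g := free_R + λ·free₂` misses `t_R + λ t₂` at EVERY base point;
hence `g` is constant, its polar form vanishes, and `T_R = λ·T₂` (`PstarUnionRankSixBridge.eq_of_polar_eq`).  At a release witness of a path edge `f`, the forest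
identity (`PstarChordBridgeForest.forest_minimality`, defect `1` by `defect_eq_one`) gives `g = t_R + λ t₂ + [f ∈ T_R] + λ [f ∈ T₂]`, i.e. `[f ∈ T_R] + λ [f ∈ T₂] = 1`,
contradicting `T_R = λ·T₂`.
-/

set_option linter.dupNamespace false -- `Summit.PneNP.PneNP.…`: summit = sub-problem name (D-0017 single-conjunct layout)

open Finset Module Literature.Computability.Complexity
open Summit.PneNP.PneNP.Theorems.PstarFibrePolys (bit bit_injective)
open Summit.PneNP.PneNP.Theorems.PstarTyped (Typed)
open Summit.PneNP.PneNP.Theorems.PstarSALevel (varSet bdry BoundaryExpanding SimpleOverlap)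
open Summit.PneNP.PneNP.Theorems.PstarGapOneAll (gval)
open Summit.PneNP.PneNP.Theorems.PstarXCore (xverts)
open Summit.PneNP.PneNP.Theorems.PstarProductRank (qform polar polar_apply)
open Summit.PneNP.PneNP.Theorems.PstarChordRepair (IsChord)
open Summit.PneNP.PneNP.Theorems.PstarChordBridgeTools
open Summit.PneNP.PneNP.Theorems.PstarChordBridge
open Summit.PneNP.PneNP.Theorems.PstarChordBridgeForcing (freeMon freePolar free_add coef_of_unread)
open Summit.PneNP.PneNP.Theorems.PstarChordBridgeForest (forest_minimality defect_eq_one)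
open Summit.PneNP.PneNP.Theorems.PstarUnionRankSixBridge (freePolar_eq_polar_union eq_of_polar_eq eq_of_union_eq)

namespace Summit.PneNP.PneNP.Theorems.PstarUnionSingleRelease

variable {n m : ℕ}

/-- The `𝔽₂` core: if the affine map `s ↦ (F₁ + ⟨ρ₁, s⟩, F₂ + ⟨ρ₂, s⟩)` misses `(t₁, t₂)` for every state `s ∈ 𝔽₂²` and the second read vector is non-zero, then the first
read vector is `λ ·` the second, `λ := if ρ₂ = 1 then ρ₁ else ρ₁'`, and `F₁ + λ F₂ = t₁ + λ t₂ + 1`. -/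
private theorem reads_cases : ∀ (ρ₁ ρ₁' ρ₂ ρ₂' F₁ F₂ t₁ t₂ : ZMod 2), (ρ₂ ≠ 0 ∨ ρ₂' ≠ 0) →
    (∀ s₁ s₂ : ZMod 2, ¬ (F₁ + (s₁ * ρ₁ + s₂ * ρ₁') = t₁ ∧ F₂ + (s₁ * ρ₂ + s₂ * ρ₂') = t₂)) →
    ρ₁ = (if ρ₂ = 1 then ρ₁ else ρ₁') * ρ₂ ∧ ρ₁' = (if ρ₂ = 1 then ρ₁ else ρ₁') * ρ₂' ∧
      F₁ + (if ρ₂ = 1 then ρ₁ else ρ₁') * F₂ = t₁ + (if ρ₂ = 1 then ρ₁ else ρ₁') * t₂ + 1 := by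
  decide

/-- The private-free monomials lie among the monomials. -/
private theorem freeMon_subset (I : LocalMap 4 n m) (N G : Finset (Fin m)) : freeMon I N G ⊆ G := by
  intro g hg
  unfold PstarChordBridgeForcing.freeMon at hg
  exact (mem_filter.1 hg).1

/-- **A reader not released by the single chord is released by no path edge.** -/
theorem false_of_path_release (I : LocalMap 4 n m) (hI : I.IsPure xorAndPred) (hT : Typed I) (hS : SimpleOverlap I) {B : BridgeData n m} (hW : B.WF I)
    (hL : Lift I B) (hG₁ : Disjoint B.G₁ B.J₀) (hG₂ : Disjoint B.G₂ B.J₀)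
    (hun : ∀ v ∈ privs I B.N, (∀ g ∈ B.G₁, I.vars g 2 ≠ v ∧ I.vars g 3 ≠ v) ∧ ∀ g ∈ B.G₂, I.vars g 2 ≠ v ∧ I.vars g 3 ≠ v)
    (hT3 : ¬ ∃ z, Solution I B B.J₀ z) {c₀ : Fin m} (hN : B.N = {c₀}) (hreads : I.vars c₀ 2 ∈ B.C₂ ∨ I.vars c₀ 3 ∈ B.C₂)
    (hnc : ¬ ∃ z, Solution I B (B.J₀.erase c₀) z) {f : Fin m} (hf : f ∈ B.D c₀) {z : Fin n → Bool} (hz : Solution I B (B.J₀.erase f) z) :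
    False := by
  classical
  have hc₀ : c₀ ∈ B.N := by rw [hN]; exact mem_singleton_self _
  have hp2 : I.vars c₀ 2 ∈ privs I B.N := vars_mem_privs I hc₀ (s := 2) (by decide)
  have hp3 : I.vars c₀ 3 ∈ privs I B.N := vars_mem_privs I hc₀ (s := 3) (by decide)
  have h23 : I.vars c₀ 2 ≠ I.vars c₀ 3 := fun h => absurd (hI.2 c₀ h) (by decide)
  -- the (constant) read coefficients
  set ρ₁ : ZMod 2 := if I.vars c₀ 2 ∈ B.C₁ then 1 else 0 with hρ₁
  set ρ₁' : ZMod 2 := if I.vars c₀ 3 ∈ B.C₁ then 1 else 0 with hρ₁'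
  set ρ₂ : ZMod 2 := if I.vars c₀ 2 ∈ B.C₂ then 1 else 0 with hρ₂
  set ρ₂' : ZMod 2 := if I.vars c₀ 3 ∈ B.C₂ then 1 else 0 with hρ₂'
  have hco₁ : ∀ x, coef I B.C₁ B.G₁ (I.vars c₀ 2) x = ρ₁ := fun x => coef_of_unread I (hun _ hp2).1 x
  have hco₁' : ∀ x, coef I B.C₁ B.G₁ (I.vars c₀ 3) x = ρ₁' := fun x => coef_of_unread I (hun _ hp3).1 x
  have hco₂ : ∀ x, coef I B.C₂ B.G₂ (I.vars c₀ 2) x = ρ₂ := fun x => coef_of_unread I (hun _ hp2).2 x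
  have hco₂' : ∀ x, coef I B.C₂ B.G₂ (I.vars c₀ 3) x = ρ₂' := fun x => coef_of_unread I (hun _ hp3).2 x
  have hread' : ρ₂ ≠ 0 ∨ ρ₂' ≠ 0 := by
    rcases hreads with h | h
    · left; rw [hρ₂, if_pos h]; exact one_ne_zero
    · right; rw [hρ₂', if_pos h]; exact one_ne_zero
  -- the model values in closed form
  have hval : ∀ (x : Fin n → ZMod 2) (s : Fin m → ZMod 2 × ZMod 2), (sys I B).val B.N x s =
      (free I B.y (B.J₀ \ B.N) B.N B.T₁ B.C₁ B.G₁ x + ((s c₀).1 * ρ₁ + (s c₀).2 * ρ₁'),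
       free I B.y (B.J₀ \ B.N) B.N B.T₂ B.C₂ B.G₂ x + ((s c₀).1 * ρ₂ + (s c₀).2 * ρ₂')) := by
    intro x s
    rw [val_sys, hN, sum_singleton, sum_singleton, hco₁, hco₁', hco₂, hco₂']
  -- over the forest every base point and every state of the pair is realised, so non-release by `c₀` is a pointwise miss
  have hmiss : ∀ (a : Fin n → ZMod 2) (s₁ s₂ : ZMod 2),
      ¬ (free I B.y (B.J₀ \ B.N) B.N B.T₁ B.C₁ B.G₁ a + (s₁ * ρ₁ + s₂ * ρ₁') = bit B.b₁ ∧
         free I B.y (B.J₀ \ B.N) B.N B.T₂ B.C₂ B.G₂ a + (s₁ * ρ₂ + s₂ * ρ₂') = bit B.b₂) := by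
    intro a s₁ s₂ hhit
    apply hnc
    obtain ⟨z₁, hz₁, hz₁x⟩ := hL fun v => toBool (a v)
    set w : Fin n → Bool := setPriv I B.N (fun _ => (toBool s₁, toBool s₂)) z₁ with hw
    have hwF : ∀ j ∈ B.J₀ \ B.N, I.eval w j = B.y j := fun j hj => by
      rw [hw, eval_setPriv_of_mem_sdiff I hW.hN hW.hchord _ z₁ hj]; exact hz₁ j hj
    have hagree : ∀ v, v ∉ xverts I (B.J₀ \ B.N) → v ∉ privs I B.N → (fun v => bit (w v)) v = a v := by
      intro v hvx hvp
      show bit (w v) = a v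
      rw [hw, setPriv_of_not_mem I _ z₁ hvp, hz₁x v hvx, bit_toBool]
    have hw2 : bit (w (I.vars c₀ 2)) = s₁ := by rw [hw, setPriv_two I hW.hN hW.hchord _ z₁ hc₀]; exact bit_toBool _
    have hw3 : bit (w (I.vars c₀ 3)) = s₂ := by rw [hw, setPriv_three I hI hW.hN hW.hchord _ z₁ hc₀]; exact bit_toBool _
    have hv := val_of_solution I hI hT hW hwF
    rw [hval, free_congr I hT hW hW.hT₁ B.C₁ B.G₁ hagree, free_congr I hT hW hW.hT₂ B.C₂ B.G₂ hagree] at hv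
    simp only [hw2, hw3] at hv
    rw [hhit.1, hhit.2] at hv
    refine ⟨w, fun j hj => hwF j (mem_erase.1 hj |> fun h => mem_sdiff.2 ⟨h.2, by rw [hN, mem_singleton]; exact h.1⟩), ?_, ?_⟩
    · exact bit_injective (congrArg Prod.fst hv).symm
    · exact bit_injective (congrArg Prod.snd hv).symm
  -- the singular read matrix and the constant blind combination
  set lam : ZMod 2 := if ρ₂ = 1 then ρ₁ else ρ₁' with hlam
  have hpt : ∀ a : Fin n → ZMod 2, ρ₁ = lam * ρ₂ ∧ ρ₁' = lam * ρ₂' ∧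
      free I B.y (B.J₀ \ B.N) B.N B.T₁ B.C₁ B.G₁ a + lam * free I B.y (B.J₀ \ B.N) B.N B.T₂ B.C₂ B.G₂ a = bit B.b₁ + lam * bit B.b₂ + 1 :=
    fun a => reads_cases ρ₁ ρ₁' ρ₂ ρ₂' _ _ _ _ hread' (hmiss a)
  obtain ⟨hl₁, hl₁', -⟩ := hpt 0
  -- the polar form of `g = free₁ + λ free₂` vanishes, so `T₁ = λ T₂`
  have hdis₁ : Disjoint B.T₁ (freeMon I B.N B.G₁) := (hG₁.symm.mono_left (hW.hT₁.trans sdiff_subset)).mono_right (freeMon_subset I B.N B.G₁)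
  have hdis₂ : Disjoint B.T₂ (freeMon I B.N B.G₂) := (hG₂.symm.mono_left (hW.hT₂.trans sdiff_subset)).mono_right (freeMon_subset I B.N B.G₂)
  have hpol : ∀ x w, freePolar I B.N B.T₁ B.G₁ x w + lam * freePolar I B.N B.T₂ B.G₂ x w = 0 := by
    intro x w
    have e₁ := free_add I B.y (B.J₀ \ B.N) B.N B.T₁ B.C₁ B.G₁ x w
    have e₂ := free_add I B.y (B.J₀ \ B.N) B.N B.T₂ B.C₂ B.G₂ x w
    have gxw := (hpt (x + w)).2.2
    have gx := (hpt x).2.2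
    have gw := (hpt w).2.2
    have g0 := (hpt 0).2.2
    rw [e₁, e₂] at gxw
    revert gxw gx gw g0
    generalize free I B.y (B.J₀ \ B.N) B.N B.T₁ B.C₁ B.G₁ x = a₁; generalize free I B.y (B.J₀ \ B.N) B.N B.T₁ B.C₁ B.G₁ w = b₁
    generalize free I B.y (B.J₀ \ B.N) B.N B.T₁ B.C₁ B.G₁ 0 = c₁; generalize freePolar I B.N B.T₁ B.G₁ x w = d₁
    generalize free I B.y (B.J₀ \ B.N) B.N B.T₂ B.C₂ B.G₂ x = a₂; generalize free I B.y (B.J₀ \ B.N) B.N B.T₂ B.C₂ B.G₂ w = b₂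
    generalize free I B.y (B.J₀ \ B.N) B.N B.T₂ B.C₂ B.G₂ 0 = c₂; generalize freePolar I B.N B.T₂ B.G₂ x w = d₂
    generalize bit B.b₁ = t₁; generalize bit B.b₂ = t₂; generalize lam = l
    revert a₁ b₁ c₁ d₁ a₂ b₂ c₂ d₂ t₁ t₂ l; decide
  have hT₁₂ : ∀ j ∈ B.J₀, (j ∈ B.T₁ ↔ (lam = 1 ∧ j ∈ B.T₂)) := by
    rcases (by decide : ∀ t : ZMod 2, t = 0 ∨ t = 1) lam with hl | hl
    · -- `λ = 0`: `freePolar₁ = 0`, so `T₁ = ∅`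
      have h0 : freePolar I B.N B.T₁ B.G₁ = polar (∅ : Finset (Fin m)) (fun j => I.vars j 2) (fun j => I.vars j 3) := by
        refine LinearMap.ext₂ fun x w => ?_
        have h := hpol x w
        rw [hl, zero_mul, add_zero] at h
        rw [h, polar_apply, sum_empty]
      rw [freePolar_eq_polar_union I hdis₁] at h0
      have hE := eq_of_polar_eq I hI hS h0
      have hT₁ : B.T₁ = ∅ := subset_empty.1 (hE ▸ subset_union_left)
      intro j _
      rw [hT₁, hl]
      simp
    · -- `λ = 1`: `freePolar₁ = freePolar₂`, so `T₁ = T₂`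
      have h1 : freePolar I B.N B.T₁ B.G₁ = freePolar I B.N B.T₂ B.G₂ := by
        refine LinearMap.ext₂ fun x w => ?_
        have h := hpol x w
        rw [hl, one_mul] at h
        have e : ∀ a b : ZMod 2, a + b = 0 → a = b := by decide
        exact e _ _ h
      rw [freePolar_eq_polar_union I hdis₁, freePolar_eq_polar_union I hdis₂] at h1
      have hE := eq_of_polar_eq I hI hS h1
      have hT : B.T₁ = B.T₂ := eq_of_union_eq (hW.hT₁.trans sdiff_subset) (hW.hT₂.trans sdiff_subset)
        (hG₁.mono_left (freeMon_subset I B.N B.G₁)) (hG₂.mono_left (freeMon_subset I B.N B.G₂)) hE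
      intro j _
      rw [hT, hl]
      simp
  -- the forest point at `f`
  have hfJ : f ∈ B.J₀ := (mem_sdiff.1 (hW.hD c₀ hc₀ hf)).1
  have hpriv : ∀ G : Finset (Fin m), (∀ v ∈ privs I B.N, ∀ g ∈ G, I.vars g 2 ≠ v ∧ I.vars g 3 ≠ v) →
      ∀ g ∈ G, I.vars g 2 ≠ I.vars c₀ 2 ∧ I.vars g 2 ≠ I.vars c₀ 3 ∧ I.vars g 3 ≠ I.vars c₀ 2 ∧ I.vars g 3 ≠ I.vars c₀ 3 := by
    intro G hG g hg
    exact ⟨(hG _ hp2 g hg).1, (hG _ hp3 g hg).1, (hG _ hp2 g hg).2, (hG _ hp3 g hg).2⟩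
  obtain ⟨-, hvalf⟩ := forest_minimality I hI hT hW hc₀ hf (hpriv B.G₁ fun v hv => (hun v hv).1) (hpriv B.G₂ fun v hv => (hun v hv).2) hz
  have hδ := defect_eq_one I hI hW hc₀ hf hT3 hz
  rw [hδ, hval, sys_t] at hvalf
  have e1 := congrArg Prod.fst hvalf
  have e2 := congrArg Prod.snd hvalf
  simp only [Prod.fst_add, Prod.snd_add] at e1 e2
  obtain ⟨-, -, hg⟩ := hpt (fun v => bit (z v))
  have hiff := hT₁₂ f hfJ
  -- `[f ∈ T₁] = λ [f ∈ T₂]`, against `[f ∈ T₁] + λ [f ∈ T₂] = 1` at the forest point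
  have hind : (if f ∈ B.T₁ then (1 : ZMod 2) else 0) = lam * (if f ∈ B.T₂ then (1 : ZMod 2) else 0) := by
    rcases (by decide : ∀ t : ZMod 2, t = 0 ∨ t = 1) lam with hl | hl
    · have hf₁ : f ∉ B.T₁ := fun h => by have := (hiff.1 h).1; rw [hl] at this; exact zero_ne_one this
      rw [if_neg hf₁, hl, zero_mul]
    · by_cases hf₂ : f ∈ B.T₂
      · rw [if_pos (hiff.2 ⟨hl, hf₂⟩), if_pos hf₂, hl, one_mul]
      · have hf₁ : f ∉ B.T₁ := fun h => hf₂ (hiff.1 h).2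
        rw [if_neg hf₁, if_neg hf₂, mul_zero]
  have zaa : ∀ t : ZMod 2, t + t = 0 := by decide
  have key : (1 : ZMod 2) = 0 := by
    linear_combination e1 + lam * e2 - hg + hind - bit (z (I.vars c₀ 2)) * hl₁ - bit (z (I.vars c₀ 3)) * hl₁'
      - zaa (lam * bit (z (I.vars c₀ 2)) * ρ₂) - zaa (lam * bit (z (I.vars c₀ 3)) * ρ₂') + zaa (lam * (if f ∈ B.T₂ then (1 : ZMod 2) else 0))
  exact one_ne_zero key

end Summit.PneNP.PneNP.Theorems.PstarUnionSingleRelease
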